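import Literature.Analysis.FluidPDE.PassiveVectorGalerkin
import Literature.Analysis.FluidPDE.PassiveVectorTensorModalAdjointCoeff
import HarnessLib

/-!
# The Fourier–Galerkin scheme for the passive solenoidal vector with a CONSTANT VISCOSITY TENSOR, I:
  the truncated system, invariant supports, energy inequality, global existence

Analysis/FluidPDE proof-support file (definitions with bodies + theorems; no named facts). The tensor twin of
`PassiveVectorGalerkin` (scalar viscosity `κΔ`): first file of the genuine Galerkin ODE approximation of the
LINEAR problem `∂ₜw + (b·∇)w + ∇π = ∇·(𝔸∇w)`, `∇·w = 0` (Frisch 1995, (9.57); weak class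
`Torus.IsWeakTensorPassiveVectorOn 0` of `PassiveVectorTensorClass`) around a carrier which is, at every time,
a real divergence-free vector trigonometric polynomial `b(t) = realTrigPoly S (β t)` with coefficients in the
finite symmetric frequency set `S` (Robinson–Rodrigo–Sadowski 2016, Thm. 4.4 Steps 1–2; Constantin–Foias 1988,
Ch. 8 (8.3)–(8.9)). On the Fourier side `∇·(𝔸∇w)` is the mode-wise matrix `−4π² T_𝔸(k)`
(`Torus.symbT`, `PassiveVectorTensorFourier`), Leray-projected:

* `Torus.pvtGalerkinField 𝔸 S β c k = −4π² Π_k T_𝔸(k) (c k) − Π_k convectionCoeff S β c k` and its restriction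
  `pvtGalerkinRHS S 𝔸 β c` to coefficient vectors on `S`;
* invariance of the real divergence-free phase space (`pvtGalerkinRHS_mem`) and of the sector phase space
  `pvPhase S Sec` (`pvtGalerkinRHS_mem_pvPhase`: Bloch sectors and the zero mode are preserved);
* the **energy identity / inequality** `∑_k Re⟪c k, V k⟫ = −4π² ∑_k Re⟪c k, T_𝔸(k) c k⟫ ≤ −lo‖∇u‖²`
  for `NearIso 𝔸 lo hi` (`sum_re_inner_pvtGalerkinField_self_eq/_le`: the transport term drops out, the Leray
  projector is invisible against transversal modes, `lo|k|²|z|² ≤ Re⟨z, T_𝔸(k)z⟩` on `k^⊥`), the differential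
  form along solutions and the **sector-Poincaré decay** `∑‖α t k‖² ≤ e^{−8π² lo R² t} ∑‖α 0 k‖²`;
* **global existence** of phase-space-valued solutions for continuous real transversal carrier coefficients
  (`exists_pvtGalerkin_solution`; `ODE.exists_solution_of_apriori_bound` with the linear Lipschitz bound and the
  a priori bound from the energy inequality), for `0 ≤ lo`.

Cell `ad-ideate`, K1L_D (stmt-AnomalousDissipation-27980), tenure ruling D26-17 (seat «tensor Fourier–Galerkin
for the constant-tensor + smooth-drift coarse class», first brick). The passage to the limit, the weak formulation
and the enstrophy Gronwall bound are carried out in sequels.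

## References

* U. Frisch, *Turbulence* (CUP 1995), §9.6.3 eq. (9.57). [`Frisch1995Turbulence`]
* J. C. Robinson, J. L. Rodrigo, W. Sadowski, *The three-dimensional Navier–Stokes equations* (CUP 2016), §4.1,
  Thm. 4.4 Steps 1–2, (4.2)–(4.8). [`RobinsonRodrigoSadowski2016`]
* P. Constantin, C. Foias, *Navier–Stokes Equations* (Chicago 1988), Ch. 8, (8.3)–(8.9). [`ConstantinFoias1988`]
-/

open MeasureTheory Set Filter Topology UnitAddTorus Metric
open scoped ENNReal NNReal InnerProductSpace

noncomputable section

namespace Literature.Analysis.FluidPDE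

/-! ## The field on coefficient families `ℤ^d → ℂ^d` -/

namespace Torus

open FunctionSpaces.Torus

variable {d : Type*} [Fintype d] [DecidableEq d]

section Symbol

omit [DecidableEq d] in
/-- `T_𝔸(k)` has real entries and is even in `k`: it commutes with conjugation up to `k ↦ −k`.
[cite: Frisch1995Turbulence, §9.6.3 eq. (9.57) p. 233] -/
theorem conjVec_symbT (𝔸 : Visc4 d) (k : d → ℤ) (z : EuclideanSpace ℂ d) :
    FunctionSpaces.EuclideanSpace.conjVec (symbT 𝔸 k z) = symbT 𝔸 (-k) (FunctionSpaces.EuclideanSpace.conjVec z) := by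
  ext j
  rw [FunctionSpaces.EuclideanSpace.conjVec_apply, symbT_apply, symbT_apply, map_sum]
  refine Finset.sum_congr rfl fun i _ => ?_
  rw [map_sum]
  refine Finset.sum_congr rfl fun a _ => ?_
  rw [map_sum]
  refine Finset.sum_congr rfl fun b _ => ?_
  rw [map_mul, Complex.conj_ofReal, FunctionSpaces.EuclideanSpace.conjVec_apply]
  simp only [Pi.neg_apply, Int.cast_neg, mul_neg, neg_mul, neg_neg]

omit [DecidableEq d] in
/-- Operator-norm bound for the symbol matrix. [cite: Frisch1995Turbulence, §9.6.3 eq. (9.57) p. 233] -/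
theorem norm_symbT_le_opNorm (𝔸 : Visc4 d) (k : d → ℤ) (z : EuclideanSpace ℂ d) :
    ‖symbT 𝔸 k z‖ ≤ ‖symbTL 𝔸 k‖ * ‖z‖ := by
  rw [← symbTL_apply]
  exact (symbTL 𝔸 k).le_opNorm z

end Symbol

section Field

variable {S : Finset (d → ℤ)}

omit [DecidableEq d] in
/-- **The Fourier–Galerkin vector field of the constant-tensor passive solenoidal vector** on the frequency set
`S`, around the carrier with coefficients `β`:
`pvtGalerkinField 𝔸 S β c k = −4π² Π_k T_𝔸(k) (c k) − Π_k convectionCoeff S β c k`, the `k`-th coefficient of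
`P[∇·(𝔸∇u) − (b·∇)u]` for `b = realTrigPoly S β`, `u = realTrigPoly S c` (Frisch (9.57) on the Fourier side,
Galerkin-truncated as in Robinson–Rodrigo–Sadowski 2016, (4.5)). [cite: RobinsonRodrigoSadowski2016, Thm. 4.4 Step 1 (4.5)] -/
def pvtGalerkinField (𝔸 : Visc4 d) (S : Finset (d → ℤ)) (β c : (d → ℤ) → EuclideanSpace ℂ d)
    (k : d → ℤ) : EuclideanSpace ℂ d :=
  -(((4 * Real.pi ^ 2 : ℝ) : ℂ) • leraySym k (symbT 𝔸 k (c k))) - leraySym k (convectionCoeff S β c k)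

omit [DecidableEq d] in
/-- Unfolding of `pvtGalerkinField`. [cite: RobinsonRodrigoSadowski2016, Thm. 4.4 Step 1 (4.5)] -/
theorem pvtGalerkinField_def (𝔸 : Visc4 d) (S : Finset (d → ℤ)) (β c : (d → ℤ) → EuclideanSpace ℂ d)
    (k : d → ℤ) :
    pvtGalerkinField 𝔸 S β c k =
      -(((4 * Real.pi ^ 2 : ℝ) : ℂ) • leraySym k (symbT 𝔸 k (c k))) - leraySym k (convectionCoeff S β c k) := rfl

omit [DecidableEq d] in
/-- **Transversality**: `∑ᵢ kᵢ V(c)_k,i = 0` (both terms are Leray-projected): the Galerkin system leaves the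
divergence-free coefficients invariant (Constantin–Foias 1988, (8.3)–(8.5), `P_m H`). [cite: ConstantinFoias1988, Ch. 8 (8.3)–(8.5)] -/
theorem sum_mul_pvtGalerkinField_apply (𝔸 : Visc4 d) (S : Finset (d → ℤ))
    (β c : (d → ℤ) → EuclideanSpace ℂ d) (k : d → ℤ) :
    ∑ i, (k i : ℂ) * pvtGalerkinField 𝔸 S β c k i = 0 := by
  have h1 : ∑ i, (k i : ℂ) * ((((4 * Real.pi ^ 2 : ℝ) : ℂ) • leraySym k (symbT 𝔸 k (c k))) i) =
      (((4 * Real.pi ^ 2 : ℝ) : ℂ)) * ∑ i, (k i : ℂ) * leraySym k (symbT 𝔸 k (c k)) i := by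
    rw [Finset.mul_sum]
    refine Finset.sum_congr rfl fun i _ => ?_
    rw [PiLp.smul_apply, smul_eq_mul]
    ring
  simp only [pvtGalerkinField, PiLp.sub_apply, PiLp.neg_apply, mul_sub, mul_neg,
    Finset.sum_sub_distrib, Finset.sum_neg_distrib, sum_mul_leraySym_apply, h1, mul_zero,
    neg_zero, sub_zero]

omit [DecidableEq d] in
/-- The field is transversal on `S` (invariance of `P_m H`). [cite: ConstantinFoias1988, Ch. 8 (8.3)–(8.5)] -/
theorem isTransversal_pvtGalerkinField (𝔸 : Visc4 d) {S : Finset (d → ℤ)}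
    (β c : (d → ℤ) → EuclideanSpace ℂ d) : IsTransversal S (pvtGalerkinField 𝔸 S β c) :=
  fun k _ => sum_mul_pvtGalerkinField_apply 𝔸 S β c k

omit [DecidableEq d] in
/-- **Conjugate symmetry** of the field for conjugate-symmetric carrier and state coefficients on a symmetric
`S` (the flow preserves real fields). [cite: ConstantinFoias1988, Ch. 8 (8.3)–(8.5)] -/
theorem _root_.Literature.Analysis.FunctionSpaces.Torus.IsConjSymm.pvtGalerkinField (𝔸 : Visc4 d)
    {S : Finset (d → ℤ)} (hS : ∀ k ∈ S, -k ∈ S)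
    {β c : (d → ℤ) → EuclideanSpace ℂ d} (hβ : IsConjSymm β) (hc : IsConjSymm c) :
    IsConjSymm (pvtGalerkinField 𝔸 S β c) := by
  intro k
  have hcc := (hβ.convectionCoeff hS hc) k
  rw [pvtGalerkinField_def, pvtGalerkinField_def, FunctionSpaces.EuclideanSpace.conjVec_sub,
    FunctionSpaces.EuclideanSpace.conjVec_neg, FunctionSpaces.EuclideanSpace.conjVec_smul, Complex.conj_ofReal,
    hc k, leraySym_neg_freq, leraySym_neg_freq, hcc, conjVec_leraySym, conjVec_leraySym, conjVec_symbT]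

omit [DecidableEq d] in
/-- **The zero mode is stationary**: `V(c) 0 = 0` when `c 0 = 0` and the carrier is transversal on `S`
(`T_𝔸(0) = 0`; the transport contributions to the zero mode cancel by transversality of the carrier).
[cite: ConstantinFoias1988, Ch. 8 (8.3)–(8.5)] -/
theorem pvtGalerkinField_zero_freq (𝔸 : Visc4 d) {S : Finset (d → ℤ)} {β c : (d → ℤ) → EuclideanSpace ℂ d}
    (hβT : IsTransversal S β) (hc0 : c 0 = 0) : pvtGalerkinField 𝔸 S β c 0 = 0 := by
  have h := pvGalerkinField_zero_freq 0 (S := S) hβT hc0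
  rw [pvGalerkinField_def, hc0, smul_zero, neg_zero, zero_sub, neg_eq_zero] at h
  rw [pvtGalerkinField_def, h, sub_zero, hc0, symbT_zero, leraySym_zero, smul_zero, neg_zero]

omit [DecidableEq d] in
/-- **Support propagation**: if `c` vanishes off a set `Sec` stable under translation by the carrier
frequencies, then `V(c)` vanishes off `Sec`. [cite: ConstantinFoias1988, Ch. 8 (8.3)–(8.5)] -/
theorem pvtGalerkinField_eq_zero_of_support (𝔸 : Visc4 d) {S : Finset (d → ℤ)} {Sec : Set (d → ℤ)}
    {β c : (d → ℤ) → EuclideanSpace ℂ d}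
    (hSec : ∀ k l, β l ≠ 0 → k - l ∈ Sec → k ∈ Sec) (hc : ∀ k, k ∉ Sec → c k = 0) {k : d → ℤ} (hk : k ∉ Sec) :
    pvtGalerkinField 𝔸 S β c k = 0 := by
  have h := pvGalerkinField_eq_zero_of_support 0 (S := S) hSec hc hk
  rw [pvGalerkinField_def, hc k hk, smul_zero, neg_zero, zero_sub, neg_eq_zero] at h
  rw [pvtGalerkinField_def, h, sub_zero, hc k hk, symbT_zero, leraySym_zero, smul_zero, neg_zero]

/-! ### The energy identity and inequality -/

/-- **The energy identity of the tensor Galerkin system**: for real transversal `c` and a real divergence-free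
carrier `β` on a symmetric `S`, `∑_{k∈S} Re⟪c k, V k⟫ = −4π² ∑_{k∈S} Re⟪c k, T_𝔸(k) (c k)⟫` (the transport
term drops out: `∑ Re⟪c k, 𝓕[(b·∇)u](k)⟫ = ∫⟪u,(b·∇)u⟫ = 0`; the Leray projector is invisible against the
transversal `c k`). [cite: RobinsonRodrigoSadowski2016, Thm. 4.4 Step 2 (4.6)–(4.7)] -/
theorem sum_re_inner_pvtGalerkinField_self_eq (𝔸 : Visc4 d) (hS : ∀ k ∈ S, -k ∈ S)
    {β c : (d → ℤ) → EuclideanSpace ℂ d} (hβ : IsConjSymm β) (hβT : IsTransversal S β)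
    (hc : IsConjSymm c) (hcT : IsTransversal S c) :
    ∑ k ∈ S, (inner ℂ (c k) (pvtGalerkinField 𝔸 S β c k)).re =
      -(4 * Real.pi ^ 2 * ∑ k ∈ S, (inner ℂ (c k) (symbT 𝔸 k (c k))).re) := by
  have hu : IsSmooth (realTrigPoly S c) := isSmooth_realTrigPoly S c
  have hb : IsSmooth (realTrigPoly S β) := isSmooth_realTrigPoly S β
  have hbdiv : IsDivFree (realTrigPoly S β) := isDivFree_realTrigPoly hβT
  have hsplit : ∀ k ∈ S, (inner ℂ (c k) (pvtGalerkinField 𝔸 S β c k)).re =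
      -(4 * Real.pi ^ 2 * (inner ℂ (c k) (symbT 𝔸 k (c k))).re) -
        (inner ℂ (c k) (convectionCoeff S β c k)).re := by
    intro k hk
    rw [pvtGalerkinField, inner_sub_right, Complex.sub_re, inner_leraySym_right_of_transversal _ _
      (hcT k hk), inner_neg_right, Complex.neg_re, inner_smul_right, inner_leraySym_right_of_transversal _ _
      (hcT k hk), Complex.re_ofReal_mul]
  rw [Finset.sum_congr rfl hsplit, Finset.sum_sub_distrib, Finset.sum_neg_distrib, ← Finset.mul_sum]
  have hnl : ∑ k ∈ S, (inner ℂ (c k) (convectionCoeff S β c k)).re = 0 := by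
    have h1 := integral_inner_realTrigPoly_left hS hc ((hb.convect hu).memLp 2)
    simp_rw [mFourierCoeff_convect_realTrigPoly hS hβ hc] at h1
    rw [← h1]
    exact integral_inner_convect_right_self_eq_zero hb hbdiv hu
  rw [hnl, sub_zero]

/-- **The energy inequality of the tensor Galerkin system**: for `NearIso 𝔸 lo hi`,
`∑_{k∈S} Re⟪c k, V k⟫ ≤ −lo ‖∇u‖²_{L²}`, `u = realTrigPoly S c` (`lo|k|²|z|² ≤ Re⟨z, T_𝔸(k) z⟩` on the
transversal modes). [cite: RobinsonRodrigoSadowski2016, Thm. 4.4 Step 2 (4.6)–(4.8)] -/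
theorem sum_re_inner_pvtGalerkinField_self_le {𝔸 : Visc4 d} {lo hi : ℝ} (h𝔸 : NearIso 𝔸 lo hi)
    (hS : ∀ k ∈ S, -k ∈ S)
    {β c : (d → ℤ) → EuclideanSpace ℂ d} (hβ : IsConjSymm β) (hβT : IsTransversal S β)
    (hc : IsConjSymm c) (hcT : IsTransversal S c) :
    ∑ k ∈ S, (inner ℂ (c k) (pvtGalerkinField 𝔸 S β c k)).re ≤
      -(lo * (eGradNormSq (realTrigPoly S c)).toReal) := by
  rw [sum_re_inner_pvtGalerkinField_self_eq 𝔸 hS hβ hβT hc hcT, toReal_eGradNormSq_realTrigPoly hS hc]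
  have h : lo * (4 * Real.pi ^ 2 * ∑ k ∈ S, freqNormSq k * ‖c k‖ ^ 2) ≤
      4 * Real.pi ^ 2 * ∑ k ∈ S, (inner ℂ (c k) (symbT 𝔸 k (c k))).re := by
    rw [mul_left_comm, Finset.mul_sum]
    exact mul_le_mul_of_nonneg_left
      (Finset.sum_le_sum fun k hk => lo_mul_le_re_inner_symbT h𝔸 (hcT k hk)) (by positivity)
  linarith

/-! ### Continuity of the field -/

omit [DecidableEq d] in
/-- The field depends continuously on (finitely many coordinates of) the carrier and the state.
[cite: RobinsonRodrigoSadowski2016, Thm. 4.4 Step 1 (4.5)] -/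
theorem continuous_pvtGalerkinField (𝔸 : Visc4 d) {X : Type*} [TopologicalSpace X]
    {B C : X → (d → ℤ) → EuclideanSpace ℂ d} (hB : ∀ k, Continuous fun x => B x k)
    (hC : ∀ k, Continuous fun x => C x k) (k : d → ℤ) :
    Continuous fun x => pvtGalerkinField 𝔸 S (B x) (C x) k := by
  unfold pvtGalerkinField
  have hT : Continuous fun x => symbT 𝔸 k (C x k) :=
    ((symbTL 𝔸 k).continuous.comp (hC k)).congr fun _ => rfl
  have hL : Continuous fun x => leraySym k (symbT 𝔸 k (C x k)) := (continuous_leraySym k).comp hT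
  have h1 : Continuous fun x => ((4 * Real.pi ^ 2 : ℝ) : ℂ) • leraySym k (symbT 𝔸 k (C x k)) :=
    hL.const_smul (((4 * Real.pi ^ 2 : ℝ) : ℂ))
  exact h1.neg.sub ((continuous_leraySym k).comp (continuous_convectionCoeff hB hC k))

end Field

end Torus

/-! ## The phase space and the field on `S → ℂ^d` -/

section PVT

open FunctionSpaces.Torus Torus

variable {d : Type*} [Fintype d]

section Field

variable [DecidableEq d] {S : Finset (d → ℤ)}

variable (S) in
/-- The tensor passive-vector Galerkin field on coefficient vectors: `V(β, c)_k = pvtGalerkinField 𝔸 S β̄ c̄ k`,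
`k ∈ S`, bars denoting extension by zero. [cite: RobinsonRodrigoSadowski2016, Thm. 4.4 Step 1 (4.5)] -/
def pvtGalerkinRHS (𝔸 : Visc4 d) (β c : ↥S → EuclideanSpace ℂ d) : ↥S → EuclideanSpace ℂ d :=
  fun k => pvtGalerkinField 𝔸 S (coeffExt S β) (coeffExt S c) k

omit [DecidableEq d] in
/-- Unfolding of `pvtGalerkinRHS`. [cite: RobinsonRodrigoSadowski2016, Thm. 4.4 Step 1 (4.5)] -/
theorem pvtGalerkinRHS_apply (𝔸 : Visc4 d) (β c : ↥S → EuclideanSpace ℂ d) (k : ↥S) :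
    pvtGalerkinRHS S 𝔸 β c k = pvtGalerkinField 𝔸 S (coeffExt S β) (coeffExt S c) k := rfl

omit [DecidableEq d] in
/-- **Invariance of the Galerkin phase space**: for real carrier coefficients the field maps real
divergence-free coefficient vectors to real divergence-free ones. [cite: ConstantinFoias1988, Ch. 8 (8.3)–(8.5)] -/
theorem pvtGalerkinRHS_mem (𝔸 : Visc4 d) (hS : ∀ k ∈ S, -k ∈ S) {β c : ↥S → EuclideanSpace ℂ d}
    (hβ : IsRealCoeff β) (hc : c ∈ galerkinSubspace S) :
    pvtGalerkinRHS S 𝔸 β c ∈ galerkinSubspace S := by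
  refine ⟨?_, ?_⟩
  · exact isRealCoeff_restrict
      ((hβ.isConjSymm_coeffExt hS).pvtGalerkinField 𝔸 hS (hc.1.isConjSymm_coeffExt hS))
  · exact isSolenoidalCoeff_restrict (isTransversal_pvtGalerkinField 𝔸 (coeffExt S β) (coeffExt S c))

omit [DecidableEq d] in
/-- **Invariance of the sector phase space** `pvPhase S Sec` under the tensor Galerkin field (Bloch sectors and
the zero mode are preserved). [cite: ConstantinFoias1988, Ch. 8 (8.3)–(8.5)] -/
theorem pvtGalerkinRHS_mem_pvPhase (𝔸 : Visc4 d) (hS : ∀ k ∈ S, -k ∈ S) {Sec : Set (d → ℤ)}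
    {β c : ↥S → EuclideanSpace ℂ d} (hβ : IsRealCoeff β) (hβT : IsSolenoidalCoeff β)
    (hSec : ∀ k l, coeffExt S β l ≠ 0 → k - l ∈ Sec → k ∈ Sec) (hc : c ∈ pvPhase S Sec) :
    pvtGalerkinRHS S 𝔸 β c ∈ pvPhase S Sec := by
  refine ⟨pvtGalerkinRHS_mem 𝔸 hS hβ hc.1, fun k hk => ?_⟩
  have hcext : ∀ m : d → ℤ, (m ∉ Sec ∨ m = 0) → coeffExt S c m = 0 := by
    intro m hm
    by_cases hmS : m ∈ S
    · rw [coeffExt_of_mem c hmS]; exact hc.2 ⟨m, hmS⟩ hm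
    · exact coeffExt_of_not_mem c hmS
  rw [pvtGalerkinRHS_apply]
  rcases hk with hk | hk
  · refine pvtGalerkinField_eq_zero_of_support 𝔸 (Sec := {m | m ∈ Sec ∧ m ≠ 0} ∪ {m | m ∈ Sec}) ?_ ?_ ?_
    · intro k' l hβl hkl
      have hkl' : k' - l ∈ Sec := by
        rcases hkl with h | h
        · exact h.1
        · exact h
      exact Or.inr (hSec k' l hβl hkl')
    · intro m hm
      simp only [Set.mem_union, Set.mem_setOf_eq, not_or, not_and, not_not] at hm
      exact hcext m (Or.inl hm.2)
    · simp only [Set.mem_union, Set.mem_setOf_eq, not_or, not_and]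
      exact ⟨fun h => absurd h hk, hk⟩
  · rw [hk]
    exact pvtGalerkinField_zero_freq 𝔸 hβT.isTransversal_coeffExt (hcext 0 (Or.inr rfl))

/-! ### Lipschitz and continuity bounds -/

variable (S) in
/-- The symbol constant of the frequency set: `4π² Σ_{k∈S} ‖T_𝔸(k)‖`. [cite: RobinsonRodrigoSadowski2016, Thm. 4.4 Step 1] -/
def symbConst (𝔸 : Visc4 d) : ℝ := 4 * Real.pi ^ 2 * ∑ k ∈ S, ‖symbTL 𝔸 k‖

omit [DecidableEq d] in
/-- The symbol constant is nonnegative. [cite: RobinsonRodrigoSadowski2016, Thm. 4.4 Step 1] -/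
theorem symbConst_nonneg (𝔸 : Visc4 d) : 0 ≤ symbConst S 𝔸 := by
  unfold symbConst; positivity

omit [DecidableEq d] in
/-- **Linear Lipschitz bound**: `‖V(β, c) − V(β, c')‖ ≤ (symbConst S 𝔸 + 2π M_S ‖β‖) ‖c − c'‖` on `S → ℂ^d`
(sup norms; the field is linear in the state). [cite: RobinsonRodrigoSadowski2016, Thm. 4.4 Step 1] -/
theorem norm_pvtGalerkinRHS_sub_le (𝔸 : Visc4 d) (β c c' : ↥S → EuclideanSpace ℂ d) :
    ‖pvtGalerkinRHS S 𝔸 β c - pvtGalerkinRHS S 𝔸 β c'‖ ≤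
      (symbConst S 𝔸 + 2 * Real.pi * (S.card * ∑ m ∈ S, ∑ j, |(m j : ℝ)|) * ‖β‖) * ‖c - c'‖ := by
  set M : ℝ := S.card * ∑ m ∈ S, ∑ j, |(m j : ℝ)| with hM
  have hM0 : 0 ≤ M := by positivity
  have hK : 0 ≤ symbConst S 𝔸 + 2 * Real.pi * M * ‖β‖ := by
    have := symbConst_nonneg (S := S) 𝔸; positivity
  refine (pi_norm_le_iff_of_nonneg (by positivity)).2 fun k => ?_
  rw [Pi.sub_apply, pvtGalerkinRHS_apply, pvtGalerkinRHS_apply, pvtGalerkinField_def, pvtGalerkinField_def]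
  have hβl : ∀ l ∈ S, ‖coeffExt S β l‖ ≤ ‖β‖ := fun l _ => norm_coeffExt_le β l
  have hdl : ∀ l ∈ S, ‖(coeffExt S c - coeffExt S c') l‖ ≤ ‖c - c'‖ := fun l _ => by
    rw [← coeffExt_sub]; exact norm_coeffExt_le _ l
  -- the tensor Stokes term
  have h1 : ‖-(((4 * Real.pi ^ 2 : ℝ) : ℂ) • leraySym k (symbT 𝔸 k (coeffExt S c k))) -
      -(((4 * Real.pi ^ 2 : ℝ) : ℂ) • leraySym k (symbT 𝔸 k (coeffExt S c' k)))‖ ≤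
      symbConst S 𝔸 * ‖c - c'‖ := by
    rw [neg_sub_neg, ← smul_sub, ← leraySym_sub, norm_smul, Complex.norm_real,
      Real.norm_of_nonneg (by positivity : (0 : ℝ) ≤ 4 * Real.pi ^ 2)]
    have hsub : symbT 𝔸 k (coeffExt S c' k) - symbT 𝔸 k (coeffExt S c k) =
        symbT 𝔸 k (coeffExt S c' k - coeffExt S c k) := by
      rw [sub_eq_add_neg, ← neg_one_smul ℂ (symbT 𝔸 k (coeffExt S c k)), ← symbT_smul, ← symbT_add, neg_one_smul,
        ← sub_eq_add_neg]
    have hcc : ‖coeffExt S c' k - coeffExt S c k‖ ≤ ‖c - c'‖ := by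
      rw [norm_sub_rev]; exact hdl k k.2
    have hTk : ‖symbTL 𝔸 k‖ ≤ ∑ k' ∈ S, ‖symbTL 𝔸 k'‖ :=
      Finset.single_le_sum (f := fun k' => ‖symbTL 𝔸 k'‖) (fun _ _ => norm_nonneg _) k.2
    calc 4 * Real.pi ^ 2 * ‖leraySym k (symbT 𝔸 k (coeffExt S c' k) - symbT 𝔸 k (coeffExt S c k))‖
        ≤ 4 * Real.pi ^ 2 * (‖symbTL 𝔸 k‖ * ‖c - c'‖) := by
          refine mul_le_mul_of_nonneg_left ((norm_leraySym_le _ _).trans ?_) (by positivity)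
          rw [hsub]
          exact (norm_symbT_le_opNorm 𝔸 k _).trans (mul_le_mul_of_nonneg_left hcc (norm_nonneg _))
      _ ≤ 4 * Real.pi ^ 2 * ((∑ k' ∈ S, ‖symbTL 𝔸 k'‖) * ‖c - c'‖) :=
          mul_le_mul_of_nonneg_left (mul_le_mul_of_nonneg_right hTk (norm_nonneg _)) (by positivity)
      _ = symbConst S 𝔸 * ‖c - c'‖ := by unfold symbConst; ring
  -- the projected transport term (linear in the state)
  have h2 : ‖leraySym k (convectionCoeff S (coeffExt S β) (coeffExt S c) k) -
      leraySym k (convectionCoeff S (coeffExt S β) (coeffExt S c') k)‖ ≤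
      2 * Real.pi * M * ‖β‖ * ‖c - c'‖ := by
    refine (norm_leraySym_sub_le _ _ _).trans ?_
    rw [← convectionCoeff_sub_right]
    have hb := norm_convectionCoeff_le S (R := ‖β‖) (R' := ‖c - c'‖) hβl hdl (k : d → ℤ)
    rw [← hM] at hb
    exact hb
  have heq : -(((4 * Real.pi ^ 2 : ℝ) : ℂ) • leraySym k (symbT 𝔸 k (coeffExt S c k))) -
        leraySym k (convectionCoeff S (coeffExt S β) (coeffExt S c) k) -
        (-(((4 * Real.pi ^ 2 : ℝ) : ℂ) • leraySym k (symbT 𝔸 k (coeffExt S c' k))) -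
          leraySym k (convectionCoeff S (coeffExt S β) (coeffExt S c') k)) =
      (-(((4 * Real.pi ^ 2 : ℝ) : ℂ) • leraySym k (symbT 𝔸 k (coeffExt S c k))) -
          -(((4 * Real.pi ^ 2 : ℝ) : ℂ) • leraySym k (symbT 𝔸 k (coeffExt S c' k)))) -
        (leraySym k (convectionCoeff S (coeffExt S β) (coeffExt S c) k) -
          leraySym k (convectionCoeff S (coeffExt S β) (coeffExt S c') k)) := by
    abel
  rw [heq]
  have hK := (norm_sub_le _ _).trans (add_le_add h1 h2)
  linarith [hK]

omit [DecidableEq d] in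
/-- The field vanishes at the zero state (linearity for a prescribed carrier). [cite: RobinsonRodrigoSadowski2016, Thm. 4.4 Step 1 (4.5)] -/
theorem pvtGalerkinRHS_zero (𝔸 : Visc4 d) (β : ↥S → EuclideanSpace ℂ d) : pvtGalerkinRHS S 𝔸 β 0 = 0 := by
  funext k
  rw [pvtGalerkinRHS_apply, coeffExt_zero, pvtGalerkinField_def, convectionCoeff_zero_right]
  simp [leraySym_zero]

omit [DecidableEq d] in
/-- Linear growth bound `‖V(β, c)‖ ≤ L(‖β‖) ‖c‖`. [cite: RobinsonRodrigoSadowski2016, Thm. 4.4 Step 1 (4.5)] -/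
theorem norm_pvtGalerkinRHS_le (𝔸 : Visc4 d) (β c : ↥S → EuclideanSpace ℂ d) :
    ‖pvtGalerkinRHS S 𝔸 β c‖ ≤
      (symbConst S 𝔸 + 2 * Real.pi * (S.card * ∑ m ∈ S, ∑ j, |(m j : ℝ)|) * ‖β‖) * ‖c‖ := by
  have h := norm_pvtGalerkinRHS_sub_le 𝔸 β c 0
  rwa [pvtGalerkinRHS_zero, sub_zero, sub_zero] at h

omit [DecidableEq d] in
/-- Continuity of the field along continuous carrier and state curves. [cite: RobinsonRodrigoSadowski2016, Thm. 4.4 Step 1 (4.5)] -/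
theorem ContinuousOn.pvtGalerkinRHS (𝔸 : Visc4 d) {s : Set ℝ} {β α : ℝ → ↥S → EuclideanSpace ℂ d}
    (hβ : ContinuousOn β s) (hα : ContinuousOn α s) :
    ContinuousOn (fun t => pvtGalerkinRHS S 𝔸 (β t) (α t)) s := by
  rw [continuousOn_iff_continuous_restrict] at hβ hα ⊢
  refine continuous_pi fun k => ?_
  have h1 : ∀ l : d → ℤ, Continuous fun x : s => coeffExt S (β x) l := by
    intro l
    by_cases hl : l ∈ S
    · simp_rw [coeffExt_of_mem _ hl]
      exact (continuous_apply _).comp hβ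
    · simp_rw [coeffExt_of_not_mem _ hl]
      exact continuous_const
  have h2 : ∀ l : d → ℤ, Continuous fun x : s => coeffExt S (α x) l := by
    intro l
    by_cases hl : l ∈ S
    · simp_rw [coeffExt_of_mem _ hl]
      exact (continuous_apply _).comp hα
    · simp_rw [coeffExt_of_not_mem _ hl]
      exact continuous_const
  exact continuous_pvtGalerkinField 𝔸 h1 h2 k

omit [DecidableEq d] in
/-- Continuity of the field in time for a fixed state, along a continuous carrier curve. [cite: RobinsonRodrigoSadowski2016, Thm. 4.4 Step 1 (4.5)] -/
theorem continuous_pvtGalerkinRHS_left (𝔸 : Visc4 d) {β : ℝ → ↥S → EuclideanSpace ℂ d} (hβ : Continuous β)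
    (c : ↥S → EuclideanSpace ℂ d) : Continuous fun t => pvtGalerkinRHS S 𝔸 (β t) c := by
  have h := ContinuousOn.pvtGalerkinRHS 𝔸 (s := Set.univ) hβ.continuousOn (continuousOn_const (c := c))
  exact continuousOn_univ.1 h

end Field

/-! ## The energy along solutions: identity, inequality and decay -/

section Energy

variable [DecidableEq d] {S : Finset (d → ℤ)}

omit [DecidableEq d] in
/-- **The energy identity in differential form along a tensor Galerkin solution**: if `α' = V(β(t), α)`
within `s` at `t`, then `d/dt ∑_k ‖α k‖² = 2 ∑_k Re⟪α k, V k⟫`. [cite: RobinsonRodrigoSadowski2016, Thm. 4.4 Step 2 (4.6)] -/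
theorem hasDerivWithinAt_pvtEnergy (𝔸 : Visc4 d)
    {α : ℝ → ↥S → EuclideanSpace ℂ d} {β : ↥S → EuclideanSpace ℂ d} {s : Set ℝ} {t : ℝ}
    (h : HasDerivWithinAt α (pvtGalerkinRHS S 𝔸 β (α t)) s t) :
    HasDerivWithinAt (fun τ => ∑ k, ‖α τ k‖ ^ 2)
      (2 * ∑ k ∈ S, (inner ℂ (coeffExt S (α t) k)
        (pvtGalerkinField 𝔸 S (coeffExt S β) (coeffExt S (α t)) k)).re) s t := by
  have h1 := hasDerivWithinAt_sum_norm_sq h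
  have h2 : ∑ k, 2 * (inner ℂ (α t k) (pvtGalerkinRHS S 𝔸 β (α t) k)).re =
      2 * ∑ k ∈ S, (inner ℂ (coeffExt S (α t) k)
        (pvtGalerkinField 𝔸 S (coeffExt S β) (coeffExt S (α t)) k)).re := by
    rw [Finset.mul_sum, sum_coeffExt (fun k v => 2 * (inner ℂ v
      (pvtGalerkinField 𝔸 S (coeffExt S β) (coeffExt S (α t)) k)).re)]
    rfl
  rw [h2] at h1
  exact h1

/-- **The energy inequality in differential form**: for `NearIso 𝔸 lo hi`, real divergence-free `α t` and
`β`, the derivative `2 ∑_k Re⟪α k, V k⟫` is at most `−2 lo ‖∇u‖²`, `u = realTrigPoly S ᾱ`.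
[cite: RobinsonRodrigoSadowski2016, Thm. 4.4 Step 2 (4.6)–(4.7)] -/
theorem pvtEnergy_deriv_le {𝔸 : Visc4 d} {lo hi : ℝ} (h𝔸 : NearIso 𝔸 lo hi) (hS : ∀ k ∈ S, -k ∈ S)
    {c β : ↥S → EuclideanSpace ℂ d} (hc : c ∈ galerkinSubspace S)
    (hβ : IsRealCoeff β) (hβT : IsSolenoidalCoeff β) :
    2 * ∑ k ∈ S, (inner ℂ (coeffExt S c k) (pvtGalerkinField 𝔸 S (coeffExt S β) (coeffExt S c) k)).re ≤
      2 * -(lo * (eGradNormSq (realTrigPoly S (coeffExt S c))).toReal) :=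
  mul_le_mul_of_nonneg_left (sum_re_inner_pvtGalerkinField_self_le h𝔸 hS (hβ.isConjSymm_coeffExt hS)
    hβT.isTransversal_coeffExt (hc.1.isConjSymm_coeffExt hS) hc.2.isTransversal_coeffExt) (by norm_num)

/-- **Energy decay of tensor Galerkin solutions** (Grönwall). Let `α` solve the Galerkin ODE on `[0, s']` with
`NearIso 𝔸 lo hi`, `lo ≥ 0`, staying real divergence free and vanishing at every `k` with `|k|² < R²`, along a
real divergence-free carrier curve `β`. Then `∑_k ‖α t k‖² ≤ e^{−8π² lo R² t} ∑_k ‖α 0 k‖²` on `[0, s']`.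
With `R = 0`: the energy is non-increasing. [cite: RobinsonRodrigoSadowski2016, Thm. 4.4 Step 2 (4.8)] -/
theorem pvtEnergy_decay_of_solution {𝔸 : Visc4 d} {lo hi : ℝ} (h𝔸 : NearIso 𝔸 lo hi) (hlo : 0 ≤ lo)
    (hS : ∀ k ∈ S, -k ∈ S)
    {β : ℝ → ↥S → EuclideanSpace ℂ d} (hβr : ∀ t, IsRealCoeff (β t)) (hβT : ∀ t, IsSolenoidalCoeff (β t))
    {s' : ℝ} {α : ℝ → ↥S → EuclideanSpace ℂ d}
    (hα : ∀ t ∈ Icc 0 s', HasDerivWithinAt α (pvtGalerkinRHS S 𝔸 (β t) (α t)) (Icc 0 s') t)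
    (hmem : ∀ t ∈ Icc 0 s', α t ∈ galerkinSubspace S) {R : ℝ}
    (hR : ∀ t ∈ Icc 0 s', ∀ k : ↥S, freqNormSq (k : d → ℤ) < R ^ 2 → α t k = 0) :
    ∀ t ∈ Icc 0 s', ∑ k, ‖α t k‖ ^ 2 ≤ Real.exp (-(8 * Real.pi ^ 2 * lo * R ^ 2) * t) * ∑ k, ‖α 0 k‖ ^ 2 := by
  intro t ht
  set ψ : ℝ → ℝ := fun τ => ∑ k, ‖α τ k‖ ^ 2 with hψ
  set ψ' : ℝ → ℝ := fun τ => 2 * ∑ k ∈ S, (inner ℂ (coeffExt S (α τ) k)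
    (pvtGalerkinField 𝔸 S (coeffExt S (β τ)) (coeffExt S (α τ)) k)).re with hψ'
  have hderiv : ∀ τ ∈ Icc 0 s', HasDerivWithinAt ψ (ψ' τ) (Icc 0 s') τ := fun τ hτ =>
    hasDerivWithinAt_pvtEnergy 𝔸 (hα τ hτ)
  have hcont : ContinuousOn ψ (Icc 0 s') := fun τ hτ => (hderiv τ hτ).continuousWithinAt
  have hbound : ∀ τ ∈ Ico 0 s', ψ' τ ≤ -(8 * Real.pi ^ 2 * lo * R ^ 2) * ψ τ + 0 := by
    intro τ hτ
    have hP := sector_poincare hS (hmem τ (Ico_subset_Icc_self hτ)).1 (hR τ (Ico_subset_Icc_self hτ))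
    have hE := pvtEnergy_deriv_le h𝔸 hS (hmem τ (Ico_subset_Icc_self hτ)) (hβr τ) (hβT τ)
    have : ψ' τ = 2 * ∑ k ∈ S, (inner ℂ (coeffExt S (α τ) k)
      (pvtGalerkinField 𝔸 S (coeffExt S (β τ)) (coeffExt S (α τ)) k)).re := rfl
    rw [this, add_zero]
    nlinarith
  have hgron := le_gronwallBound_of_liminf_deriv_right_le (f := ψ) (f' := ψ') (δ := ψ 0)
    (K := -(8 * Real.pi ^ 2 * lo * R ^ 2)) (ε := 0) (a := 0) (b := s') hcont (fun τ hτ r hr => ?_) le_rfl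
    hbound t ht
  · rw [sub_zero, gronwallBound_ε0] at hgron
    rw [mul_comm]
    exact hgron
  · have hmem_nhds : Icc 0 s' ∈ 𝓝[Ici τ] τ :=
      mem_nhdsWithin.2 ⟨Iio s', isOpen_Iio, hτ.2, fun z hz => ⟨hτ.1.trans hz.2, hz.1.le⟩⟩
    exact ((hderiv τ (Ico_subset_Icc_self hτ)).mono_of_mem_nhdsWithin hmem_nhds)
      |>.liminf_right_slope_le hr

end Energy

/-! ## Global solutions of the tensor Galerkin ODE in the sector phase space -/

section Global

variable [DecidableEq d] {S : Finset (d → ℤ)}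

/-- **Global existence for the tensor passive-vector Galerkin system in a sector phase space.**
Let `S` be a finite symmetric frequency set, `NearIso 𝔸 lo hi` with `lo ≥ 0`, `β : ℝ → (S → ℂ^d)` a continuous
curve of real transversal carrier coefficients, `Sec` a frequency set stable under translation by the carrier
frequencies at all times, and `c₀ ∈ pvPhase S Sec`. Then `α' = V(β(t), α)` has a solution `α : ℝ → (S → ℂ^d)` with
`α 0 = c₀`, valued in `pvPhase S Sec`, continuous on `[0, ∞)` and solving the equation on every `[0, T]`; its
coefficient energy is non-increasing. [cite: RobinsonRodrigoSadowski2016, Thm. 4.4 Steps 1–2] -/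
theorem exists_pvtGalerkin_solution {𝔸 : Visc4 d} {lo hi : ℝ} (h𝔸 : NearIso 𝔸 lo hi) (hlo : 0 ≤ lo)
    (hS : ∀ k ∈ S, -k ∈ S)
    {β : ℝ → ↥S → EuclideanSpace ℂ d} (hβ : Continuous β) (hβr : ∀ t, IsRealCoeff (β t))
    (hβT : ∀ t, IsSolenoidalCoeff (β t)) {Sec : Set (d → ℤ)}
    (hSec : ∀ t k l, coeffExt S (β t) l ≠ 0 → k - l ∈ Sec → k ∈ Sec)
    {c₀ : ↥S → EuclideanSpace ℂ d} (hc₀ : c₀ ∈ pvPhase S Sec) :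
    ∃ α : ℝ → ↥S → EuclideanSpace ℂ d, α 0 = c₀ ∧ (∀ t, α t ∈ pvPhase S Sec) ∧
      ContinuousOn α (Ici 0) ∧
      (∀ T, ∀ t ∈ Icc 0 T, HasDerivWithinAt α (pvtGalerkinRHS S 𝔸 (β t) (α t)) (Icc 0 T) t) ∧
      ∀ t, 0 ≤ t → ∑ k, ‖α t k‖ ^ 2 ≤ ∑ k, ‖c₀ k‖ ^ 2 := by
  set Y := pvPhase S Sec with hY
  set V : ℝ → Y → Y := fun t c =>
    ⟨pvtGalerkinRHS S 𝔸 (β t) c, pvtGalerkinRHS_mem_pvPhase 𝔸 hS (hβr t) (hβT t) (hSec t) c.2⟩ with hV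
  have hVcoe : ∀ t (c : Y), ((V t c : Y) : ↥S → EuclideanSpace ℂ d) = pvtGalerkinRHS S 𝔸 (β t) c :=
    fun t c => rfl
  -- Lipschitz, uniformly on `[0, T]` (linear field, continuous carrier)
  have hlip : ∀ T ρ : ℝ, ∃ K : ℝ≥0, ∀ t ∈ Icc 0 T, LipschitzOnWith K (V t) (closedBall 0 ρ) := by
    intro T ρ
    obtain ⟨Cβ, hCβ⟩ := isCompact_Icc.exists_bound_of_continuousOn (hβ.continuousOn (s := Icc 0 T))
    refine ⟨Real.toNNReal (symbConst S 𝔸 +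
        2 * Real.pi * (S.card * ∑ m ∈ S, ∑ j, |(m j : ℝ)|) * Cβ), fun t ht => ?_⟩
    refine LipschitzOnWith.of_dist_le_mul fun c _ c' _ => ?_
    rw [Subtype.dist_eq, dist_eq_norm, dist_eq_norm, hVcoe, hVcoe]
    refine (norm_pvtGalerkinRHS_sub_le 𝔸 (β t) (c : ↥S → EuclideanSpace ℂ d) (c' : ↥S → EuclideanSpace ℂ d)).trans ?_
    refine mul_le_mul_of_nonneg_right ?_ (norm_nonneg _)
    refine le_trans ?_ (Real.le_coe_toNNReal _)
    have hM : 0 ≤ 2 * Real.pi * ((S.card : ℝ) * ∑ m ∈ S, ∑ j, |(m j : ℝ)|) := by positivity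
    nlinarith [hCβ t ht, hM]
  -- continuity in time
  have hcont : ∀ c : Y, ContinuousOn (V · c) (Ici 0) := by
    intro c
    refine Continuous.continuousOn ?_
    exact (continuous_pvtGalerkinRHS_left 𝔸 hβ (c : ↥S → EuclideanSpace ℂ d)).subtype_mk _
  -- a priori bound from the non-increase of the energy
  have hapriori : ∀ T : ℝ, 0 ≤ T → ∃ R : ℝ, ‖(⟨c₀, hc₀⟩ : Y)‖ ≤ R ∧
      ∀ s ∈ Icc 0 T, ∀ α : ℝ → Y, α 0 = ⟨c₀, hc₀⟩ →
        (∀ t ∈ Icc 0 s, HasDerivWithinAt α (V t (α t)) (Icc 0 s) t) →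
        ∀ t ∈ Icc 0 s, ‖α t‖ ≤ R := by
    intro T hT
    set R : ℝ := Real.sqrt (∑ k, ‖c₀ k‖ ^ 2) with hR
    refine ⟨R, ?_, ?_⟩
    · change ‖c₀‖ ≤ R
      exact norm_le_sqrt_sum_norm_sq c₀
    · intro s hs α hα0 hα t ht
      set γ : ℝ → ↥S → EuclideanSpace ℂ d := fun τ => (α τ : ↥S → EuclideanSpace ℂ d) with hγ
      have hγ' : ∀ τ ∈ Icc 0 s, HasDerivWithinAt γ (pvtGalerkinRHS S 𝔸 (β τ) (γ τ)) (Icc 0 s) τ := by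
        intro τ hτ
        exact Y.subtypeL.hasFDerivAt.comp_hasDerivWithinAt τ (hα τ hτ)
      have hmem : ∀ τ ∈ Icc 0 s, γ τ ∈ galerkinSubspace S := fun τ _ => (α τ).2.1
      have hdec := pvtEnergy_decay_of_solution h𝔸 hlo hS hβr hβT hγ' hmem (R := 0)
        (fun τ _ k hk => absurd hk (by rw [sq, zero_mul]; exact not_lt.2 (freqNormSq_nonneg _))) t ht
      have hγ0 : γ 0 = c₀ := by simp [hγ, hα0]
      rw [hγ0] at hdec
      have hdec' : ∑ k, ‖γ t k‖ ^ 2 ≤ ∑ k, ‖c₀ k‖ ^ 2 := by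
        refine hdec.trans ?_
        have : Real.exp (-(8 * Real.pi ^ 2 * lo * 0 ^ 2) * t) = 1 := by simp
        rw [this, one_mul]
      change ‖γ t‖ ≤ R
      exact (norm_le_sqrt_sum_norm_sq (γ t)).trans (Real.sqrt_le_sqrt hdec')
  obtain ⟨α, hα0, hα⟩ := ODE.exists_solution_of_apriori_bound hlip hcont hapriori
  have hsol : ∀ T, ∀ t ∈ Icc 0 T, HasDerivWithinAt (fun t => (α t : ↥S → EuclideanSpace ℂ d))
      (pvtGalerkinRHS S 𝔸 (β t) (α t)) (Icc 0 T) t := fun T t ht =>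
    Y.subtypeL.hasFDerivAt.comp_hasDerivWithinAt t (hα T t ht)
  refine ⟨fun t => (α t : ↥S → EuclideanSpace ℂ d), by simp [hα0], fun t => (α t).2, ?_, hsol, ?_⟩
  · intro t ht
    have hc := IsIntegralCurveOn.continuousOn (hα (t + 1)) t ⟨ht, by linarith⟩
    have hmem : Icc 0 (t + 1) ∈ 𝓝[Ici 0] t :=
      Filter.mem_of_superset (inter_mem_nhdsWithin (Ici (0 : ℝ)) (Iio_mem_nhds (by linarith)))
        fun s hs => ⟨hs.1, hs.2.le⟩
    exact (continuous_subtype_val.continuousAt.comp_continuousWithinAt hc).mono_of_mem_nhdsWithin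
      hmem
  · intro t ht
    have hdec := pvtEnergy_decay_of_solution h𝔸 hlo hS hβr hβT (hsol t) (fun τ _ => (α τ).2.1) (R := 0)
      (fun τ _ k hk => absurd hk (by rw [sq, zero_mul]; exact not_lt.2 (freqNormSq_nonneg _))) t
      ⟨ht, le_rfl⟩
    have h0 : ((α 0 : Y) : ↥S → EuclideanSpace ℂ d) = c₀ := by simp [hα0]
    rw [h0] at hdec
    refine hdec.trans ?_
    have : Real.exp (-(8 * Real.pi ^ 2 * lo * 0 ^ 2) * t) = 1 := by simp
    rw [this, one_mul]

end Global

end PVT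

end Literature.Analysis.FluidPDE
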